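import Summits.QuantumFields.BalabanUV.Beta.GAN24.ExitPairingSourceForm
import Summits.QuantumFields.BalabanUV.Beta.GAN24.ContactLambdaCommutator
import Summits.QuantumFields.BalabanUV.Beta.GAN24.HessianGaugeLegContact
import Summits.QuantumFields.BalabanUV.Beta.GAN24.ContactOneGaugeCellMaxwell
import Summits.QuantumFields.BalabanUV.Beta.AveragingPointsOfView
import Summits.QuantumFields.BalabanUV.Beta.GAN24.GaugeReadChargeProfile

/-!
# `BalabanUV.Beta.GAN24.CombFreeGaugeLegCharges` — binder row G-an2-4 ∕ (CONV-C), the (S) row of RULING R-gan24p1-g27-1 B (viii), the Ward-type half (W-γ) (road-P2 g39), EXIT class,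
# jb = 0: **THE TWO-LEG CHARGES OF THE LEVEL-0 TABLES AGAINST (COMB-FREE 1-FORM) ⊗ (PURE GAUGE), PER SLOT, IN CLOSED FORM; THE ℋ-COLUMN WARD PAIRING WITH ITS CONTOUR TERM;
# COMB-FREE FORMS HAVE ROOTED AVERAGE = STRAIGHT CONTOUR SUM** (G-an2-4 formalisation swarm → CRUX TEAM (2), seat `b2b-balaban-gan24-formalise-leaf-06` = the (γ) hand, gen 47, INTENT 1 FILE A;
# the table algebra behind ENGINE E-leaf06-g46-1 (M1)∕(M3))

NOT IN PRINT; OUR BOOKKEEPING ([folklore] BY NAME over: leaf-02's second-slot `dψ`-laws `ContactOneGaugeCellAlgebra.tsum_wilsonA_mul_dz` (cubic Wilson table) and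
`HessianGaugeLegContact.tsum_hessFFAt_mul_dz` (rooted constraint Hessian), leaf-02's Maxwell contraction `ContactOneGaugeCellMaxwell.tsum_mul_curvAdj_curv_delta1` and commutator form
`ContactLambdaCommutator.tsum_sum_mul_gaugeWeight_mul_linKerAt`, an2's `isCombBondAt_of_mem_axial` ∕ `RootedComb.axProjAt_eq_self_of_axialGaugeAt` ∕ `AveragingPointsOfView.linAvgAt_eq_contourSum_axProjAt`,
leaf-06 g46's `RelInvWardPairing.ward_pairing` at `W = idK`, leaf-06 g44∕g45's `hasSum_prod_wsum_fine` ∕ `KernelLegCharges.hasSum_prod_wsum` ∕ `GaugeReadChargeProfile` absorption lemmas;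
0 `def`, 0 cited fact, 0 `def … : Prop`, 0 sorry).  HONEST FRAMING (cell contract, verbatim): «discharging `BetaPertH` makes Bałaban's UV stability UNCONDITIONAL — a real
constructive-QFT result; it is NOT the continuum limit and NOT the Clay problem.»  HONEST DEPENDENCY (verbatim): «continuum YM on T⁴ ⇐ BetaPertH ∧ nine spine estimates (0/9 proved);
BetaPertH ⇐ (D1) ∧ (D4) ∧ CAP+tail; G-an2-4 gates asym, D1 and NE2/3/4.»

WHY.  After g46's `ExitPairingSourceForm` the (γ) exit pairing at jb = 0 is the two-leg charge of the slot derivative `𝒟(e) = dM G₀ Lc S₀ M₀ ν y′` against `n ⊗ dz ψ`, where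
`n = Π^ρ m̃ − (Lc^{d+1})⁻¹(𝒬m̃)⊙𝟙^{exit}` is bounded, COMB-FREE, with VANISHING block contour sums, and `ψ = 1_{B(y)}`.  `𝒟(e)` superposes the level-0 tables — the cubic Wilson table
`W l t` (the border table has no ff block) weighted by the ℋ-column `colH G₀(e)`, and the rooted constraint Hessians `h^ρ_b` weighted by the multiplier column `colM G₀(e)`.  THIS FILE
evaluates the charge of each table in closed form and supplies the column Ward pairing that converts the Wilson remainder into contour sums:
* §1 `axialGaugeAt_of_comb_zero`, `axProjAt_eq_self_of_comb_zero`, **`linAvgAt_eq_contourSum_of_comb_zero`** (a comb-free 1-form is rooted-axial; `Π^ρ` fixes it; its ROOTED linear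
  average `linAvgAt ρ` is the STRAIGHT block contour sum `𝒬_N`).
* §2 **`tsum_curvAdj_curv_mul_inr_col_eq`** (generic `RelInv G (bhK N) (axEc ρ N)`, `f` bounded comb-free: `Σ'_u Σ_κ (d*d f) κ u·G u (N•y′)(inl κ)(inr ν) = Σ'_w Σ_κ 𝒬_N f κ w·G (N•w)(N•y′)(inr κ)(inr ν)`
  — g46's `ward_pairing` at `W = idK`; g46 INTENT 3's `tsum_curvAdj_curv_mul_inr_col_eq_zero` is its periodic case) and the instance **`tsum_curvAdj_curv_mul_colH_eq`** for `G₀`.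
* §3 `hasSum_prod_of_support` (two-site functions of finite support: product sum = iterated sum).
* §4 `wilsonA_inl_inl_eq_zero_of_not_mem`, **`wilsonA_gaugeLeg_charge`** (EVERY 1-form `n`, EVERY `ψ`, slot `(l,t)`: `Σ'_u Σ_κ n κ u·(Σ'_x Σ_κ₂ W l t u x (inl κ)(inl κ₂)·dzψ κ₂ x)
  = −½ψ(t+e_l)·(d*d n)_l(t) + ¼(d*d(σ_ψ⊙n))_l(t)`, `σ_ψ(κ,u) := ψ u + ψ(u+e_κ)`), `hasSum_prod_wilsonA_gaugeLeg` (the same over `Site × Site`, channel-summed).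
* §5 `hessFFAt_inl_inl_eq_zero_of_not_mem₂`, **`hessFFAt_gaugeLeg_charge`** (box root; `n` comb-free with `𝒬_L n = 0`: `Σ'_u Σ_κ n κ u·(Σ'_x Σ_κ₂ h^ρ_{(μ,w)} u x (inl κ)(inl κ₂)·dzψ κ₂ x)
  = −(2L^{d+1})⁻¹·𝒬_L(σ_ψ⊙n) μ w`), `hasSum_prod_hessFFAt_gaugeLeg`.
* §6 **`hasSum_prod_weight_vertexOfK`** ∕ **`hasSum_prod_weight_vertexOfM`** (the two-leg charge of a chain-rule vertex against a bounded two-leg weight `ω` = column weights × charges of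
  the absorbed tables `ω•S` ∕ `ω•M`).  §7 bounds (`abs_curvAdj_curv_le`, `abs_bondSum_mul_le`; `abs_dz_le` is an2's `KKTFluctuationEnergy.abs_dz_le`).
Asserts NO value of any resolvent column; NOTHING of (W-γ) ∕ (INV) ∕ (S) ∕ (Q-R) ∕ «T2Shape» ∕ (hW, hWall) discharged; NEVER «G-an2-4 closed» as (CONV-C); NOT D1, NOT `BetaPertH`,
NOT continuum, NOT Clay.  2026-08-22; no existing file touched.
-/

noncomputable section

open Finset
open scoped BigOperators
open Literature.MathematicalPhysics.QuantumFieldTheory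
open Literature.MathematicalPhysics.QuantumFieldTheory.Balaban1983to89
open Literature.MathematicalPhysics.QuantumFieldTheory.Balaban1983to89.Beta
open B12Sec2to5 (l1 l1_nonneg)
open ExpKernelCalculus (Site MKer Decays BiLoc comp summable_exp_shift')
open AffineAveraging (Form0 Form1 Form2 box toSite unitVec unitVec_apply dz curv curvAdj contourSum)
open AveragingContours (blk axial)
open AveragingContoursRooted (AxialGaugeAt linAvgAt)
open AveragingHessianKernelsRooted (hessFFAt linKerAt)
open RootedComb (axProjAt axProjAt_eq_self_of_axialGaugeAt)
open HessKerSchurResolvent (idK idK_apply comp_idK_right)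
open OneStepResolventKernel (Fib wsum LocStencil)
open OneStepKernelFamily (KInvStep colH vertexOfK abs_colH_le)
open SecondOrderResponse (colM vertexOfM abs_colM_le)
open InterLevelTransport (cwsum cwsum_apply)
open ExpKernelCalculus (VertexFamily)
open KKTFluctuationEnergy (abs_curv_le abs_dz_le)
open ResolventComposition (abs_curvAdj_le)
open Summit.QuantumFields.BalabanUV.Beta.GAN24.KernelLegCharges (hasSum_prod_wsum)
open Summit.QuantumFields.BalabanUV.Beta.GAN24.GaugeReadCharge (hasSum_prod_wsum_fine)
open Summit.QuantumFields.BalabanUV.Beta.GAN24.GaugeReadChargeProfile (locStencil_weightMul vertexFamily_weightMul wsum_weightMul_apply cwsum_weightMul_apply)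
open StepJetData (wilsonA wilsonA_antisymm)
open AveragingWardStencils (b6UnitVec_eq)
open Summit.QuantumFields.BalabanUV.Beta.LinearGaugeVH (nearBox mem_nearBox summable_of_finsupp)
open KKTFluctuationKernel (delta1)
open Summit.QuantumFields.BalabanUV.Beta.TameKernelCalculus
open Summit.QuantumFields.BalabanUV.Beta.ChartConjugationRelative (RelInv)
open Summit.QuantumFields.BalabanUV.Beta.AxialDressingRooted (IsCombBondAt axEc coDressKBmAt spr_coDressKBmAt one_le_of_neZero cube mem_cube)
open Summit.QuantumFields.BalabanUV.Beta.BorderedHessian (bhK relInv_coDressKBmAt_KInvStep_zero isCombBondAt_of_mem_axial)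
open Summit.QuantumFields.BalabanUV.Beta.AveragingPointsOfView (linAvgAt_eq_contourSum_axProjAt)
open Summit.QuantumFields.BalabanUV.Beta.GAN24.RelInvWardPairing (ward_pairing)
open Summit.QuantumFields.BalabanUV.Beta.GAN24.ContactOneGaugeCellAlgebra (tsum_wilsonA_mul_dz wilsonA_inl_inl_eq_zero_of_lt wilsonA_inl_inl_eq_zero_of_lt_right mem_cube_two_of_l1_le)
open Summit.QuantumFields.BalabanUV.Beta.GAN24.ContactOneGaugeCellMaxwell (tsum_mul_curvAdj_curv_delta1 summable_mul_curvAdj_curv_delta1)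
open Summit.QuantumFields.BalabanUV.Beta.GAN24.HessianGaugeLegContact (tsum_hessFFAt_mul_dz hessFFAt_inl_inl_eq_zero_of_not_mem hessFFAt_inl_inl_eq_zero_of_not_mem_right)
open Summit.QuantumFields.BalabanUV.Beta.GAN24.ContactLambdaCommutator (tsum_sum_mul_gaugeWeight_mul_linKerAt)

namespace Summit.QuantumFields.BalabanUV.Beta.GAN24.CombFreeGaugeLegCharges

variable {d : ℕ}

/-! ## §1 Comb-free 1-forms: the rooted projector fixes them and their rooted average is the straight block contour sum -/

/-- [folklore] **A 1-FORM VANISHING ON THE COMB BONDS IS IN THE ROOTED AXIAL GAUGE** (in-block root): every letter of the axial contour from the root is the value of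
the form on a comb bond (an2's `isCombBondAt_of_mem_axial`). -/
theorem axialGaugeAt_of_comb_zero {N : ℕ} (hN : 1 ≤ N) {r : Fin (d + 1) → ℕ} (hr : r ∈ box (d + 1) N) {f : Form1 (d + 1) ℝ}
    (hf : ∀ κ u, IsCombBondAt (toSite r) N κ u → f κ u = 0) : AxialGaugeAt (toSite r) f N := by
  intro y b hb
  refine List.sum_eq_zero fun a ha => ?_
  obtain ⟨κ, z', e, hcomb⟩ := isCombBondAt_of_mem_axial hN hr hb y ha
  rcases e with e | e
  · rw [e, hf κ z' hcomb]
  · rw [e, hf κ z' hcomb, neg_zero]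

/-- [folklore] **`Π^ρ` FIXES EVERY COMB-FREE 1-FORM** (in-block root). -/
theorem axProjAt_eq_self_of_comb_zero {N : ℕ} (hN : 1 ≤ N) {r : Fin (d + 1) → ℕ} (hr : r ∈ box (d + 1) N) {f : Form1 (d + 1) ℝ}
    (hf : ∀ κ u, IsCombBondAt (toSite r) N κ u → f κ u = 0) : axProjAt (toSite r) N f = f :=
  axProjAt_eq_self_of_axialGaugeAt hN (axialGaugeAt_of_comb_zero hN hr hf)

/-- [folklore] **THE ROOTED LINEAR AVERAGE OF A COMB-FREE 1-FORM IS ITS STRAIGHT BLOCK CONTOUR SUM**: `linAvgAt ρ f N μ y = 𝒬_N f μ y` (in-block root). -/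
theorem linAvgAt_eq_contourSum_of_comb_zero {N : ℕ} (hN : 1 ≤ N) {r : Fin (d + 1) → ℕ} (hr : r ∈ box (d + 1) N) {f : Form1 (d + 1) ℝ}
    (hf : ∀ κ u, IsCombBondAt (toSite r) N κ u → f κ u = 0) (μ : Fin (d + 1)) (y : Fin (d + 1) → ℤ) :
    linAvgAt (toSite r) f N μ y = contourSum N f μ y := by
  rw [linAvgAt_eq_contourSum_axProjAt hr f μ y, axProjAt_eq_self_of_comb_zero hN hr hf]

/-! ## §2 The multiplier-slot column pairing of a relative inverse against the Maxwell image of a comb-free form -/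

/-- NOT IN PRINT; OUR BOOKKEEPING.  **THE ℋ-COLUMN WARD PAIRING WITH ITS CONTOUR TERM**: `RelInv G (bhK N) (axEc ρ N)`, `G` spread, `f` bounded and zero on the comb bonds ⇒
for every multiplier slot `(ν, y′)`: `Σ'_u Σ_κ (d*d f) κ u·G u (N•y′) (inl κ) (inr ν) = Σ'_w Σ_κ (𝒬_N f) κ w·G (N•w) (N•y′) (inr κ) (inr ν)` — `ward_pairing` at `W = idK`;
the source term is `idK`'s `(inl, inr)` block `= 0`.  (leaf-06 g46's `EdgePotentialColumnOrthogonal.tsum_curvAdj_curv_mul_inr_col_eq_zero` is the periodic case, where the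
right-hand side vanishes.) -/
theorem tsum_curvAdj_curv_mul_inr_col_eq {N : ℕ} [NeZero N] {ρ : Fin (d + 1) → ℤ} {G : MKer (d + 1) (Fib d)}
    (hG : RelInv G (bhK N) (axEc ρ N)) (hGs : Spr G) {f : Form1 (d + 1) ℝ} {B : ℝ} (hfB : ∀ κ u, |f κ u| ≤ B)
    (hf0 : ∀ κ u, IsCombBondAt ρ N κ u → f κ u = 0) (ν : Fin (d + 1)) (y' : Fin (d + 1) → ℤ) :
    ∑' u, ∑ κ, curvAdj (curv f) κ u * G u ((N : ℤ) • y') (Sum.inl κ) (Sum.inr ν)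
      = ∑' w, ∑ κ, contourSum N f κ w * G ((N : ℤ) • w) ((N : ℤ) • y') (Sum.inr κ) (Sum.inr ν) := by
  classical
  have hW := ward_pairing hG hGs (spr_idK) hfB hf0 ((N : ℤ) • y') (Sum.inr ν)
  rw [comp_idK_right] at hW
  rw [hW]
  have h1 : (fun u => ∑ κ, f κ u * (idK : MKer (d + 1) (Fib d)) u ((N : ℤ) • y') (Sum.inl κ) (Sum.inr ν)) = fun _ => 0 := by
    funext u
    refine Finset.sum_eq_zero fun κ _ => ?_
    rw [idK_apply, if_neg (fun h => Sum.inl_ne_inr h.2), mul_zero]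
  rw [h1, tsum_zero, zero_add]

/-- NOT IN PRINT; OUR BOOKKEEPING.  **THE INSTANCE `G₀ = coDressKBmAt (toSite r) Lc (KInvStep Lc 0)`** (in-block root): for `f` bounded and comb-free,
`Σ'_u Σ_κ (d*d f) κ u·colH G₀ Lc ν y′ κ u = Σ'_w Σ_κ (𝒬_{Lc} f) κ w·colM G₀ Lc ν y′ κ w`. -/
theorem tsum_curvAdj_curv_mul_colH_eq {Lc : ℕ} [NeZero Lc] {r : Fin (d + 1) → ℕ} (hr : r ∈ box (d + 1) Lc) {f : Form1 (d + 1) ℝ} {B : ℝ}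
    (hfB : ∀ κ u, |f κ u| ≤ B) (hf0 : ∀ κ u, IsCombBondAt (toSite r) Lc κ u → f κ u = 0) (ν : Fin (d + 1)) (y' : Fin (d + 1) → ℤ) :
    ∑' u, ∑ κ, curvAdj (curv f) κ u * colH (coDressKBmAt (toSite r) Lc (KInvStep (d := d) Lc 0)) Lc ν y' κ u
      = ∑' w, ∑ κ, contourSum Lc f κ w * colM (coDressKBmAt (toSite r) Lc (KInvStep (d := d) Lc 0)) Lc ν y' κ w :=
  tsum_curvAdj_curv_mul_inr_col_eq (relInv_coDressKBmAt_KInvStep_zero hr)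
    (spr_coDressKBmAt (one_le_of_neZero Lc) hr
      (by obtain ⟨δ, C, hδ, -, h⟩ := OneStepKernelFamily.decays_KInvStep (d := d) (Lc := Lc) 0; exact ⟨C, δ, hδ, h⟩)) hfB hf0 ν y'

/-! ## §3 Two-leg sums of finitely supported tables: product form = iterated form -/

/-- [folklore] A function of two sites vanishing unless both lie in given finite sets: its product sum IS its iterated sum (both are the finite double sum). -/
theorem hasSum_prod_of_support {F : Site (d + 1) → Site (d + 1) → ℝ} (S T : Finset (Site (d + 1)))
    (hF : ∀ u x, (u ∉ S ∨ x ∉ T) → F u x = 0) :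
    HasSum (fun ux : Site (d + 1) × Site (d + 1) => F ux.1 ux.2) (∑' u, ∑' x, F u x) := by
  classical
  have h0 : ∀ p : Site (d + 1) × Site (d + 1), p ∉ S ×ˢ T → F p.1 p.2 = 0 := fun p hp => by
    rw [Finset.mem_product, not_and_or] at hp
    exact hF p.1 p.2 hp
  have h1 : HasSum (fun ux : Site (d + 1) × Site (d + 1) => F ux.1 ux.2) (∑ p ∈ S ×ˢ T, F p.1 p.2) := hasSum_sum_of_ne_finset_zero h0
  have hin : ∀ u, ∑' x, F u x = ∑ x ∈ T, F u x := fun u => tsum_eq_sum fun x hx => hF u x (Or.inr hx)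
  have h2 : ∑' u, ∑' x, F u x = ∑ u ∈ S, ∑ x ∈ T, F u x := by
    rw [tsum_eq_sum (s := S) (fun u hu => by rw [hin]; exact Finset.sum_eq_zero fun x _ => hF u x (Or.inl hu))]
    exact Finset.sum_congr rfl fun u _ => hin u
  rw [h2, ← Finset.sum_product (s := S) (t := T) (f := fun p => F p.1 p.2)]
  exact h1

/-! ## §4 The cubic Wilson table: the two-leg charge against (1-form) ⊗ (pure gauge), per slot, in closed form -/

/-- [folklore] The ff entries of the cubic Wilson table at slot `(l, t)` vanish unless BOTH fluctuation legs lie in the window `t + cube 2`. -/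
theorem wilsonA_inl_inl_eq_zero_of_not_mem (l : Fin (d + 1)) (t u x : Site (d + 1)) (κ κ₂ : Fin (d + 1))
    (h : u ∉ (cube (d + 1) 2).image (fun v => t + v) ∨ x ∉ (cube (d + 1) 2).image (fun v => t + v)) :
    wilsonA d l t u x (Sum.inl κ) (Sum.inl κ₂) = 0 := by
  classical
  have key : ∀ y : Site (d + 1), y ∉ (cube (d + 1) 2).image (fun v => t + v) → 2 < l1 (y - t) := fun y hy => by
    by_contra hle
    exact hy (Finset.mem_image.2 ⟨y - t, mem_cube_two_of_l1_le (not_lt.1 hle), by abel⟩)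
  rcases h with h | h
  · exact wilsonA_inl_inl_eq_zero_of_lt l t u x κ κ₂ (key u h)
  · exact wilsonA_inl_inl_eq_zero_of_lt_right l t u x κ κ₂ (key x h)

/-- NOT IN PRINT; OUR BOOKKEEPING.  **THE TWO-LEG CHARGE OF THE CUBIC WILSON TABLE AGAINST `n ⊗ dψ`, PER SLOT** (any 1-form `n`, any gauge function `ψ`):
`Σ'_u Σ_κ n κ u·(Σ'_x Σ_κ₂ W l t u x (inl κ)(inl κ₂)·(dz ψ) κ₂ x) = −½·ψ(t + e_l)·(d*d n)_l(t) + ¼·(d*d (σ_ψ ⊙ n))_l(t)`, `σ_ψ(κ,u) := ψ u + ψ(u + e_κ)` —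
leaf-02's second-slot `dψ`-law (`tsum_wilsonA_mul_dz`) and the Maxwell contraction (`tsum_mul_curvAdj_curv_delta1`). -/
theorem wilsonA_gaugeLeg_charge (l : Fin (d + 1)) (t : Site (d + 1)) (n : Form1 (d + 1) ℝ) (ψ : Site (d + 1) → ℝ) :
    ∑' u, ∑ κ, n κ u * (∑' x, ∑ κ₂, wilsonA d l t u x (Sum.inl κ) (Sum.inl κ₂) * dz ψ κ₂ x)
      = -(1 / 2 : ℝ) * ψ (t + unitVec l) * curvAdj (curv n) l t
        + (1 / 4 : ℝ) * curvAdj (curv (fun κ u => (ψ u + ψ (u + unitVec κ)) * n κ u)) l t := by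
  have hpt : ∀ u, (∑ κ, n κ u * (∑' x, ∑ κ₂, wilsonA d l t u x (Sum.inl κ) (Sum.inl κ₂) * dz ψ κ₂ x))
      = -(1 / 2 : ℝ) * ψ (t + unitVec l) * (∑ κ, n κ u * curvAdj (curv (delta1 l t)) κ u)
        + (1 / 4 : ℝ) * (∑ κ, ((ψ u + ψ (u + unitVec κ)) * n κ u) * curvAdj (curv (delta1 l t)) κ u) := by
    intro u
    rw [Finset.mul_sum, Finset.mul_sum, ← Finset.sum_add_distrib]
    refine Finset.sum_congr rfl fun κ _ => ?_
    rw [tsum_wilsonA_mul_dz l t u κ ψ, b6UnitVec_eq, b6UnitVec_eq]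
    ring
  rw [tsum_congr hpt]
  have s1 := summable_mul_curvAdj_curv_delta1 n l t
  have s2 := summable_mul_curvAdj_curv_delta1 (fun κ u => (ψ u + ψ (u + unitVec κ)) * n κ u) l t
  rw [(s1.mul_left _).tsum_add (s2.mul_left _), tsum_mul_left, tsum_mul_left, tsum_mul_curvAdj_curv_delta1 n l t,
    tsum_mul_curvAdj_curv_delta1 (fun κ u => (ψ u + ψ (u + unitVec κ)) * n κ u) l t]

/-- NOT IN PRINT; OUR BOOKKEEPING.  The same charge as a sum over `Site × Site` of the channel-summed integrand (the form in which the response superposition delivers it):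
`Σ'_{(u,x)} Σ_κ Σ_κ₂ n κ u·(dz ψ) κ₂ x·W l t u x (inl κ)(inl κ₂)` has the value of `wilsonA_gaugeLeg_charge`. -/
theorem hasSum_prod_wilsonA_gaugeLeg (l : Fin (d + 1)) (t : Site (d + 1)) (n : Form1 (d + 1) ℝ) (ψ : Site (d + 1) → ℝ) :
    HasSum (fun ux : Site (d + 1) × Site (d + 1) => ∑ κ, ∑ κ₂, n κ ux.1 * dz ψ κ₂ ux.2 * wilsonA d l t ux.1 ux.2 (Sum.inl κ) (Sum.inl κ₂))
      (-(1 / 2 : ℝ) * ψ (t + unitVec l) * curvAdj (curv n) l t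
        + (1 / 4 : ℝ) * curvAdj (curv (fun κ u => (ψ u + ψ (u + unitVec κ)) * n κ u)) l t) := by
  classical
  have h := hasSum_prod_of_support (F := fun u x => ∑ κ, ∑ κ₂, n κ u * dz ψ κ₂ x * wilsonA d l t u x (Sum.inl κ) (Sum.inl κ₂))
    ((cube (d + 1) 2).image (fun v => t + v)) ((cube (d + 1) 2).image (fun v => t + v))
    (fun u x hux => Finset.sum_eq_zero fun κ _ => Finset.sum_eq_zero fun κ₂ _ => by
      rw [wilsonA_inl_inl_eq_zero_of_not_mem l t u x κ κ₂ hux, mul_zero])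
  rw [← wilsonA_gaugeLeg_charge l t n ψ]
  have e : ∀ u, ∑' x, ∑ κ, ∑ κ₂, n κ u * dz ψ κ₂ x * wilsonA d l t u x (Sum.inl κ) (Sum.inl κ₂)
      = ∑ κ, n κ u * (∑' x, ∑ κ₂, wilsonA d l t u x (Sum.inl κ) (Sum.inl κ₂) * dz ψ κ₂ x) := by
    intro u
    have hs : ∀ κ, Summable fun x => ∑ κ₂, n κ u * dz ψ κ₂ x * wilsonA d l t u x (Sum.inl κ) (Sum.inl κ₂) := fun κ =>
      summable_of_finsupp ((cube (d + 1) 2).image (fun v => t + v)) fun x hx =>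
        Finset.sum_eq_zero fun κ₂ _ => by rw [wilsonA_inl_inl_eq_zero_of_not_mem l t u x κ κ₂ (Or.inr hx), mul_zero]
    rw [Summable.tsum_finsetSum (fun κ _ => hs κ)]
    refine Finset.sum_congr rfl fun κ _ => ?_
    rw [← tsum_mul_left]
    refine tsum_congr fun x => ?_
    rw [Finset.mul_sum]
    exact Finset.sum_congr rfl fun κ₂ _ => by ring
  simp only [e] at h
  exact h

/-! ## §5 The rooted constraint-Hessian table: the two-leg charge against `n ⊗ dψ` for a comb-free `n` with vanishing block contour sums -/

/-- [folklore] The ff entries of `h^ρ_b` vanish unless both fluctuation legs lie in the support box `nearBox L w` (box root). -/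
theorem hessFFAt_inl_inl_eq_zero_of_not_mem₂ {L : ℕ} {r : Fin (d + 1) → ℕ} (hr : r ∈ box (d + 1) L) (μ : Fin (d + 1)) (w u x : Site (d + 1))
    (κ κ₂ : Fin (d + 1)) (h : u ∉ nearBox L w ∨ x ∉ nearBox L w) : hessFFAt (toSite r) L μ w u x (Sum.inl κ) (Sum.inl κ₂) = 0 := by
  rcases h with h | h
  · exact hessFFAt_inl_inl_eq_zero_of_not_mem hr μ w x κ κ₂ h
  · exact hessFFAt_inl_inl_eq_zero_of_not_mem_right hr μ w u κ κ₂ h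

/-- NOT IN PRINT; OUR BOOKKEEPING.  **THE TWO-LEG CHARGE OF THE ROOTED CONSTRAINT-HESSIAN TABLE AGAINST `n ⊗ dψ`** (box root `ρ = toSite r`, `1 ≤ L`; `n` COMB-FREE with VANISHING
block contour sums; any `ψ`): `Σ'_u Σ_κ n κ u·(Σ'_x Σ_κ₂ h^ρ_{(μ,w)} u x (inl κ)(inl κ₂)·(dz ψ) κ₂ x) = −(2·L^{d+1})⁻¹·𝒬_L(σ_ψ ⊙ n) μ w` — leaf-02's second-slot `dψ`-law
(`tsum_hessFFAt_mul_dz`), leaf-02's commutator form of the gauge-weighted `q¹`-pairing (`tsum_sum_mul_gaugeWeight_mul_linKerAt`), and §1 (rooted average = straight contour sum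
for the comb-free forms `n`, `σ_ψ ⊙ n`; the coarse-bond mean of `ψ` meets `𝒬_L n = 0`). -/
theorem hessFFAt_gaugeLeg_charge {L : ℕ} (hL : 1 ≤ L) {r : Fin (d + 1) → ℕ} (hr : r ∈ box (d + 1) L) (μ : Fin (d + 1)) (w : Site (d + 1))
    {n : Form1 (d + 1) ℝ} (hn0 : ∀ κ u, IsCombBondAt (toSite r) L κ u → n κ u = 0) (hq : ∀ κ y, contourSum L n κ y = 0) (ψ : Site (d + 1) → ℝ) :
    ∑' u, ∑ κ, n κ u * (∑' x, ∑ κ₂, hessFFAt (toSite r) L μ w u x (Sum.inl κ) (Sum.inl κ₂) * dz ψ κ₂ x)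
      = -((2 * (L : ℝ) ^ (d + 1))⁻¹ * contourSum L (fun κ u => (ψ u + ψ (u + unitVec κ)) * n κ u) μ w) := by
  have hpt : ∀ u, (∑ κ, n κ u * (∑' x, ∑ κ₂, hessFFAt (toSite r) L μ w u x (Sum.inl κ) (Sum.inl κ₂) * dz ψ κ₂ x))
      = -(∑ κ, n κ u * ((ψ u + ψ (u + unitVec κ) - ψ ((L : ℤ) • w + toSite r) - ψ ((L : ℤ) • w + toSite r + (L : ℤ) • unitVec μ))
          * linKerAt (toSite r) L μ w (κ, u) / 2)) := by
    intro u
    rw [← Finset.sum_neg_distrib]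
    refine Finset.sum_congr rfl fun κ _ => ?_
    rw [tsum_hessFFAt_mul_dz hL hr μ w u κ ψ]
    ring
  rw [tsum_congr hpt, tsum_neg, tsum_sum_mul_gaugeWeight_mul_linKerAt hr ψ n μ w]
  have hσ0 : ∀ κ u, IsCombBondAt (toSite r) L κ u → (fun κ u => (ψ u + ψ (u + unitVec κ)) * n κ u) κ u = 0 := fun κ u h => by
    show (ψ u + ψ (u + unitVec κ)) * n κ u = 0
    rw [hn0 κ u h, mul_zero]
  rw [linAvgAt_eq_contourSum_of_comb_zero hL hr hσ0, linAvgAt_eq_contourSum_of_comb_zero hL hr hn0, hq, mul_zero, sub_zero]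

/-- NOT IN PRINT; OUR BOOKKEEPING.  The same charge as a sum over `Site × Site` of the channel-summed integrand. -/
theorem hasSum_prod_hessFFAt_gaugeLeg {L : ℕ} (hL : 1 ≤ L) {r : Fin (d + 1) → ℕ} (hr : r ∈ box (d + 1) L) (μ : Fin (d + 1)) (w : Site (d + 1))
    {n : Form1 (d + 1) ℝ} (hn0 : ∀ κ u, IsCombBondAt (toSite r) L κ u → n κ u = 0) (hq : ∀ κ y, contourSum L n κ y = 0) (ψ : Site (d + 1) → ℝ) :
    HasSum (fun ux : Site (d + 1) × Site (d + 1) => ∑ κ, ∑ κ₂, n κ ux.1 * dz ψ κ₂ ux.2 * hessFFAt (toSite r) L μ w ux.1 ux.2 (Sum.inl κ) (Sum.inl κ₂))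
      (-((2 * (L : ℝ) ^ (d + 1))⁻¹ * contourSum L (fun κ u => (ψ u + ψ (u + unitVec κ)) * n κ u) μ w)) := by
  classical
  have h := hasSum_prod_of_support (F := fun u x => ∑ κ, ∑ κ₂, n κ u * dz ψ κ₂ x * hessFFAt (toSite r) L μ w u x (Sum.inl κ) (Sum.inl κ₂))
    (nearBox L w) (nearBox L w)
    (fun u x hux => Finset.sum_eq_zero fun κ _ => Finset.sum_eq_zero fun κ₂ _ => by
      rw [hessFFAt_inl_inl_eq_zero_of_not_mem₂ hr μ w u x κ κ₂ hux, mul_zero])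
  rw [← hessFFAt_gaugeLeg_charge hL hr μ w hn0 hq ψ]
  have e : ∀ u, ∑' x, ∑ κ, ∑ κ₂, n κ u * dz ψ κ₂ x * hessFFAt (toSite r) L μ w u x (Sum.inl κ) (Sum.inl κ₂)
      = ∑ κ, n κ u * (∑' x, ∑ κ₂, hessFFAt (toSite r) L μ w u x (Sum.inl κ) (Sum.inl κ₂) * dz ψ κ₂ x) := by
    intro u
    have hs : ∀ κ, Summable fun x => ∑ κ₂, n κ u * dz ψ κ₂ x * hessFFAt (toSite r) L μ w u x (Sum.inl κ) (Sum.inl κ₂) := fun κ =>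
      summable_of_finsupp (nearBox L w) fun x hx =>
        Finset.sum_eq_zero fun κ₂ _ => by rw [hessFFAt_inl_inl_eq_zero_of_not_mem₂ hr μ w u x κ κ₂ (Or.inr hx), mul_zero]
    rw [Summable.tsum_finsetSum (fun κ _ => hs κ)]
    refine Finset.sum_congr rfl fun κ _ => ?_
    rw [← tsum_mul_left]
    refine tsum_congr fun x => ?_
    rw [Finset.mul_sum]
    exact Finset.sum_congr rfl fun κ₂ _ => by ring
  simp only [e] at h
  exact h

/-! ## §6 The two-leg charge of a chain-rule vertex against a bounded two-leg weight: column weights × table charges -/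

/-- [folklore] **WEIGHTED TWO-LEG CHARGE OF THE FIELD-COLUMN VERTEX**: `K` decaying (rate `δK ≥ δ > 0`), `LocStencil S Cs δ`, `|ω| ≤ B` ⇒
`Σ_{(u,x)} ω(u,x)·(vertexOfK K N S μ y) u x a b = Σ_l Σ'_t colH K N μ y l t · Σ'_{(u,x)} ω(u,x)·S l t u x a b` (the weight is absorbed into the tables; leaf-06 g44's
`hasSum_prod_wsum_fine` per stencil index). -/
theorem hasSum_prod_weight_vertexOfK {N : ℕ} [NeZero N] {K : MKer (d + 1) (Fib d)} {C δK : ℝ} (hK : Decays K C δK) (hC : 0 ≤ C)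
    {S : Fin (d + 1) → Site (d + 1) → MKer (d + 1) (Fib d)} {Cs δ : ℝ} (hS : LocStencil S Cs δ) (hδ : 0 < δ) (hδK : δ ≤ δK)
    {ω : Site (d + 1) × Site (d + 1) → ℝ} {B : ℝ} (hω : ∀ xz, |ω xz| ≤ B) (μ : Fin (d + 1)) (y : Site (d + 1)) (a b : Fib d) :
    HasSum (fun ux : Site (d + 1) × Site (d + 1) => ω ux * vertexOfK K N S μ y ux.1 ux.2 a b)
      (∑ l, ∑' t, colH K N μ y l t * ∑' ux : Site (d + 1) × Site (d + 1), ω ux * S l t ux.1 ux.2 a b) := by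
  have hw : ∀ l t, |colH K N μ y l t| ≤ C * Real.exp (-δ * l1 (t - (N : ℤ) • y)) := fun l t => by
    refine (abs_colH_le hK μ y l t).trans (mul_le_mul_of_nonneg_left (Real.exp_le_exp.2 ?_) hC)
    nlinarith [l1_nonneg (t - (N : ℤ) • y)]
  have h1 : ∀ l, HasSum (fun ux : Site (d + 1) × Site (d + 1) => ω ux * wsum (colH K N μ y l) (S l) ux.1 ux.2 a b)
      (∑' t, colH K N μ y l t * ∑' ux : Site (d + 1) × Site (d + 1), ω ux * S l t ux.1 ux.2 a b) := by
    intro l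
    have h := hasSum_prod_wsum_fine (hw l) hδ (fun t => locStencil_weightMul hS hω l t) hδ a b
    refine h.congr_fun fun ux => ?_
    exact (wsum_weightMul_apply (colH K N μ y l) (S l) ω ux.1 ux.2 a b).symm
  refine (hasSum_sum fun l (_ : l ∈ (Finset.univ : Finset (Fin (d + 1)))) => h1 l).congr_fun fun ux => ?_
  show ω ux * vertexOfK K N S μ y ux.1 ux.2 a b = ∑ l, ω ux * wsum (colH K N μ y l) (S l) ux.1 ux.2 a b
  rw [← Finset.mul_sum]
  rfl

/-- [folklore] **WEIGHTED TWO-LEG CHARGE OF THE MULTIPLIER-COLUMN VERTEX**: `K` decaying (rate `δK ≥ δ > 0`), `VertexFamily M N CM δ`, `|ω| ≤ B`, `1 ≤ N` ⇒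
`Σ_{(u,x)} ω(u,x)·(vertexOfM K N M μ y) u x a b = Σ_ρ Σ'_w colM K N μ y ρ w · Σ'_{(u,x)} ω(u,x)·M ρ w u x a b`. -/
theorem hasSum_prod_weight_vertexOfM {N : ℕ} [NeZero N] (hN : 1 ≤ N) {K : MKer (d + 1) (Fib d)} {C δK : ℝ} (hK : Decays K C δK) (hC : 0 ≤ C)
    {M : Fin (d + 1) → Site (d + 1) → MKer (d + 1) (Fib d)} {CM δ : ℝ} (hM : VertexFamily M N CM δ) (hδ : 0 < δ) (hδK : δ ≤ δK)
    {ω : Site (d + 1) × Site (d + 1) → ℝ} {B : ℝ} (hω : ∀ xz, |ω xz| ≤ B) (μ : Fin (d + 1)) (y : Site (d + 1)) (a b : Fib d) :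
    HasSum (fun ux : Site (d + 1) × Site (d + 1) => ω ux * vertexOfM K N M μ y ux.1 ux.2 a b)
      (∑ ρ, ∑' w, colM K N μ y ρ w * ∑' ux : Site (d + 1) × Site (d + 1), ω ux * M ρ w ux.1 ux.2 a b) := by
  have hw : ∀ ρ w, |colM K N μ y ρ w| ≤ C * Real.exp (-δ * l1 ((N : ℤ) • w - (N : ℤ) • y)) := fun ρ w => by
    refine (abs_colM_le hK μ y ρ w).trans (mul_le_mul_of_nonneg_left (Real.exp_le_exp.2 ?_) hC)
    nlinarith [l1_nonneg ((N : ℤ) • w - (N : ℤ) • y)]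
  have h1 : ∀ ρ, HasSum (fun ux : Site (d + 1) × Site (d + 1) => ω ux * cwsum N (colM K N μ y ρ) (M ρ) ux.1 ux.2 a b)
      (∑' w, colM K N μ y ρ w * ∑' ux : Site (d + 1) × Site (d + 1), ω ux * M ρ w ux.1 ux.2 a b) := by
    intro ρ
    have h := hasSum_prod_wsum hN (hw ρ) hδ (fun w => vertexFamily_weightMul hM hω ρ w) hδ a b
    refine h.congr_fun fun ux => ?_
    obtain ⟨u, x⟩ := ux
    show ω (u, x) * cwsum N (colM K N μ y ρ) (M ρ) u x a b = ∑' w, colM K N μ y ρ w * (ω (u, x) * M ρ w u x a b)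
    rw [← cwsum_weightMul_apply, cwsum_apply]
  refine (hasSum_sum fun ρ (_ : ρ ∈ (Finset.univ : Finset (Fin (d + 1)))) => h1 ρ).congr_fun fun ux => ?_
  show ω ux * vertexOfM K N M μ y ux.1 ux.2 a b = ∑ ρ, ω ux * cwsum N (colM K N μ y ρ) (M ρ) ux.1 ux.2 a b
  rw [← Finset.mul_sum]
  rfl

/-! ## §7 Bounds -/

/-- [folklore] `|d*d m| ≤ 16(d+1)·B` for `|m| ≤ B` (an2's `abs_curv_le`, `abs_curvAdj_le`). -/
theorem abs_curvAdj_curv_le {m : Form1 (d + 1) ℝ} {B : ℝ} (hm : ∀ κ u, |m κ u| ≤ B) (κ : Fin (d + 1)) (u : Site (d + 1)) :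
    |curvAdj (curv m) κ u| ≤ (d + 1 : ℕ) * (2 * (4 * B)) + (d + 1 : ℕ) * (2 * (4 * B)) :=
  abs_curvAdj_le (fun κ l x => abs_curv_le hm κ l x) κ u

/-- [folklore] The bond-sum weight: `|(ψ u + ψ(u + e_κ))·n κ u| ≤ 2Bψ·Bn`. -/
theorem abs_bondSum_mul_le {ψ : Site (d + 1) → ℝ} {Bψ : ℝ} (hψ : ∀ u, |ψ u| ≤ Bψ) {n : Form1 (d + 1) ℝ} {Bn : ℝ} (hn : ∀ κ u, |n κ u| ≤ Bn)
    (κ : Fin (d + 1)) (u : Site (d + 1)) : |(ψ u + ψ (u + unitVec κ)) * n κ u| ≤ 2 * Bψ * Bn := by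
  rw [abs_mul]
  have h1 : |ψ u + ψ (u + unitVec κ)| ≤ 2 * Bψ := (abs_add_le _ _).trans (by linarith [hψ u, hψ (u + unitVec κ)])
  have hB : 0 ≤ Bψ := (abs_nonneg _).trans (hψ u)
  exact mul_le_mul h1 (hn κ u) (abs_nonneg _) (by linarith)

end Summit.QuantumFields.BalabanUV.Beta.GAN24.CombFreeGaugeLegCharges

end
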